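import Literature.Analysis.OperatorTheory.PseudoResolventOperator
import HarnessLib

/-!
# The closed operator behind an injective pseudo-resolvent does not depend on the base point
  (Kato VIII-§1.1, the sentence "`T` is a linear operator in `X` with `D(T) = R`")

Analysis/OperatorTheory support file (theorems only, no definitions, no named facts), continuing
`PseudoResolventOperator.lean`. There, for a family `J : ℂ → E →L[ℂ] E` injective at `z₀`, the
partially defined operator `operatorOfResolvent J z₀ hinj : E →ₗ.[ℂ] E` (domain `Ran J(z₀)`,
`T (J(z₀) v) = z₀ J(z₀) v − v`) is constructed, and for a pseudo-resolvent on `U ∋ z₀` the ACTION is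
shown to be base-point free (`apply_resolvent_of_mem`, `resolvent_apply_sub`: `J(z) = (z − T)⁻¹` for
every `z ∈ U`). Kato (1966, VIII-§1.1, p. 428) says more: the null space `N` and the range `R` of
`R′(ζ)` are independent of `ζ`, and when `N = 0` "**`T` is a linear operator in `X` with `D(T) = R`**"
— ONE operator, whatever point `ζ₀` was used to write `u = R′(ζ₀)v(ζ₀)`. This file records exactly
that sentence as an equality of Mathlib `LinearPMap`s:

* `operatorOfResolvent_domain_eq_of_mem`, `mem_domain_iff_of_mem`: for `z₀, z₁ ∈ U` the operators
  built at `z₀` and at `z₁` have the same domain (`PseudoResolvent.range_eq`);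
* `operatorOfResolvent_apply_eq_of_mem`: they agree on the common domain (both values `y` solve
  `J(z₁)(z₁u − y) = u`, and `J(z₁)` is injective);
* **`operatorOfResolvent_eq_of_mem`**: `operatorOfResolvent J z₀ _ = operatorOfResolvent J z₁ _`
  (`LinearPMap.ext`), hence equal graphs (`operatorOfResolvent_graph_eq_of_mem`);
* `eigen_iff_eigen_of_mem`, `exists_mem_domain_iff_of_mem` (any predicate on the value `T u`),
  `eigen_add_iff_eigen_add_of_mem`: eigen-pairs `(μ, u)`, `u ∈ D(T)`, `T u = μ u` — and more generally
  "`u ∈ D(T)` with `P (T u)`", e.g. `T u + K u = w` for a rank-one feedback `K` — are the same for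
  both base points: the form in which spectral statements written with a `z₀`-indexed operator are
  read as statements about one closed operator.

What is deliberately NOT here: anything about the case `N ≠ 0` (then no single-valued `T` exists;
Kato VIII-(1.2)), and no spectral-mapping statements beyond eigen-pairs.

## References

* T. Kato, *Perturbation Theory for Linear Operators*, Springer 1966, VIII-§1.1, p. 428 (the
  paragraph "The pseudo-resolvent `R′(ζ)` is a resolvent … `T` is a linear operator in `X` with
  `D(T) = R`"; held copy chunk p0497). [Kato1966]
-/

noncomputable section

open Set

namespace Literature.Analysis.OperatorTheory

namespace IsPseudoResolvent

variable {E : Type*} [NormedAddCommGroup E] [NormedSpace ℂ E]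
variable {J : ℂ → E →L[ℂ] E} {U : Set ℂ} {z₀ z₁ : ℂ} {hinj : Function.Injective (J z₀)}
  {hinj₁ : Function.Injective (J z₁)}

/-- **The domain does not depend on the base point**: for a pseudo-resolvent on `U` and
`z₀, z₁ ∈ U`, `Ran J(z₀) = Ran J(z₁)`, so the operators built at `z₀` and at `z₁` have the same
domain ("the range `R` of `R′(ζ)` [is] independent of `ζ`"). [cite: Kato1966, VIII-§1.1 p. 428] -/
theorem operatorOfResolvent_domain_eq_of_mem (h : IsPseudoResolvent U J) (hz₀ : z₀ ∈ U)
    (hz₁ : z₁ ∈ U) :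
    (operatorOfResolvent J z₀ hinj).domain = (operatorOfResolvent J z₁ hinj₁).domain := by
  rw [operatorOfResolvent_domain, operatorOfResolvent_domain, h.range_eq hz₀ hz₁]

/-- Membership in the domain does not depend on the base point. [cite: Kato1966, VIII-§1.1 p. 428] -/
theorem mem_domain_iff_of_mem (h : IsPseudoResolvent U J) (hz₀ : z₀ ∈ U) (hz₁ : z₁ ∈ U) (u : E) :
    u ∈ (operatorOfResolvent J z₀ hinj).domain ↔ u ∈ (operatorOfResolvent J z₁ hinj₁).domain := by
  rw [h.operatorOfResolvent_domain_eq_of_mem (hinj := hinj) (hinj₁ := hinj₁) hz₀ hz₁]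

/-- **The action does not depend on the base point**: if `u` lies in the (common) domain, the
operators built at `z₀` and at `z₁` agree on `u` — both values `y` satisfy `J(z₁)(z₁u − y) = u`
(`resolvent_apply_sub`), and `J(z₁)` is injective ("`v(ζ) + ζu` is a vector independent of `ζ`;
we shall denote it by `Tu`"). [cite: Kato1966, VIII-§1.1 p. 428] -/
theorem operatorOfResolvent_apply_eq_of_mem (h : IsPseudoResolvent U J) (hz₀ : z₀ ∈ U)
    (hz₁ : z₁ ∈ U) {u : E} (hu₀ : u ∈ (operatorOfResolvent J z₀ hinj).domain)
    (hu₁ : u ∈ (operatorOfResolvent J z₁ hinj₁).domain) :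
    operatorOfResolvent J z₀ hinj ⟨u, hu₀⟩ = operatorOfResolvent J z₁ hinj₁ ⟨u, hu₁⟩ := by
  have h₀ := h.resolvent_apply_sub (hinj := hinj) hz₀ hz₁ hu₀
  have h₁ := h.resolvent_apply_sub (hinj := hinj₁) hz₁ hz₁ hu₁
  have heq : z₁ • u - operatorOfResolvent J z₀ hinj ⟨u, hu₀⟩ =
      z₁ • u - operatorOfResolvent J z₁ hinj₁ ⟨u, hu₁⟩ :=
    hinj₁ (h₀.trans h₁.symm)
  exact sub_right_injective heq

/-- **The closed operator behind a pseudo-resolvent is independent of the base point**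
(Kato VIII-§1.1: `T` is ONE operator with `D(T) = R` and `R′(ζ) = (T − ζ)⁻¹` for every `ζ`):
for `z₀, z₁ ∈ U`, `operatorOfResolvent J z₀ = operatorOfResolvent J z₁` as partially defined
operators. [cite: Kato1966, VIII-§1.1 p. 428] -/
theorem operatorOfResolvent_eq_of_mem (h : IsPseudoResolvent U J) (hz₀ : z₀ ∈ U) (hz₁ : z₁ ∈ U) :
    operatorOfResolvent J z₀ hinj = operatorOfResolvent J z₁ hinj₁ :=
  LinearPMap.ext (h.operatorOfResolvent_domain_eq_of_mem hz₀ hz₁)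
    fun _ hu₀ hu₁ => h.operatorOfResolvent_apply_eq_of_mem hz₀ hz₁ hu₀ hu₁

/-- The graphs agree (same closed operator). [cite: Kato1966, VIII-§1.1 p. 428] -/
theorem operatorOfResolvent_graph_eq_of_mem (h : IsPseudoResolvent U J) (hz₀ : z₀ ∈ U)
    (hz₁ : z₁ ∈ U) :
    (operatorOfResolvent J z₀ hinj).graph = (operatorOfResolvent J z₁ hinj₁).graph := by
  rw [h.operatorOfResolvent_eq_of_mem (hinj := hinj) (hinj₁ := hinj₁) hz₀ hz₁]

/-- **Eigen-pairs do not depend on the base point**: `u ∈ D(T)` with `T u = μ u` for the operator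
built at `z₀` iff the same holds for the operator built at `z₁`. [cite: Kato1966, VIII-§1.1 p. 428] -/
theorem eigen_iff_eigen_of_mem (h : IsPseudoResolvent U J) (hz₀ : z₀ ∈ U) (hz₁ : z₁ ∈ U) (μ : ℂ)
    (u : E) :
    (∃ hu : u ∈ (operatorOfResolvent J z₀ hinj).domain,
        operatorOfResolvent J z₀ hinj ⟨u, hu⟩ = μ • u) ↔
      ∃ hu : u ∈ (operatorOfResolvent J z₁ hinj₁).domain,
        operatorOfResolvent J z₁ hinj₁ ⟨u, hu⟩ = μ • u := by
  constructor
  · rintro ⟨hu, hT⟩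
    have hu₁ := (h.mem_domain_iff_of_mem (hinj := hinj) (hinj₁ := hinj₁) hz₀ hz₁ u).1 hu
    exact ⟨hu₁, (h.operatorOfResolvent_apply_eq_of_mem hz₀ hz₁ hu hu₁).symm.trans hT⟩
  · rintro ⟨hu, hT⟩
    have hu₀ := (h.mem_domain_iff_of_mem (hinj := hinj) (hinj₁ := hinj₁) hz₀ hz₁ u).2 hu
    exact ⟨hu₀, (h.operatorOfResolvent_apply_eq_of_mem hz₀ hz₁ hu₀ hu).trans hT⟩

/-- **"`u ∈ D(T)` and `P (T u)`" does not depend on the base point**, for an arbitrary predicate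
`P` on the value `T u` (e.g. `T u = σ u − θ ℓ(u) f` for a rank-one feedback, `T u + K u = w`, …) —
the shape in which perturbed spectral statements written with a `z₀`-indexed operator are read as
statements about the one closed operator. [cite: Kato1966, VIII-§1.1 p. 428] -/
theorem exists_mem_domain_iff_of_mem (h : IsPseudoResolvent U J) (hz₀ : z₀ ∈ U) (hz₁ : z₁ ∈ U)
    (u : E) (P : E → Prop) :
    (∃ hu : u ∈ (operatorOfResolvent J z₀ hinj).domain, P (operatorOfResolvent J z₀ hinj ⟨u, hu⟩)) ↔
      ∃ hu : u ∈ (operatorOfResolvent J z₁ hinj₁).domain,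
        P (operatorOfResolvent J z₁ hinj₁ ⟨u, hu⟩) := by
  constructor
  · rintro ⟨hu, hT⟩
    have hu₁ := (h.mem_domain_iff_of_mem (hinj := hinj) (hinj₁ := hinj₁) hz₀ hz₁ u).1 hu
    exact ⟨hu₁, h.operatorOfResolvent_apply_eq_of_mem hz₀ hz₁ hu hu₁ ▸ hT⟩
  · rintro ⟨hu, hT⟩
    have hu₀ := (h.mem_domain_iff_of_mem (hinj := hinj) (hinj₁ := hinj₁) hz₀ hz₁ u).2 hu
    exact ⟨hu₀, (h.operatorOfResolvent_apply_eq_of_mem hz₀ hz₁ hu₀ hu).symm ▸ hT⟩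

/-- **Same eigen-pairs, perturbed form**: for a map `K : E → E` (e.g. a bounded rank-one feedback)
and any right-hand side `w`, "`u ∈ D(T)` with `T u + K u = w`" holds for the operator built at `z₀`
iff it holds for the operator built at `z₁`. [cite: Kato1966, VIII-§1.1 p. 428] -/
theorem eigen_add_iff_eigen_add_of_mem (h : IsPseudoResolvent U J) (hz₀ : z₀ ∈ U) (hz₁ : z₁ ∈ U)
    (K : E → E) (w : E) (u : E) :
    (∃ hu : u ∈ (operatorOfResolvent J z₀ hinj).domain,
        operatorOfResolvent J z₀ hinj ⟨u, hu⟩ + K u = w) ↔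
      ∃ hu : u ∈ (operatorOfResolvent J z₁ hinj₁).domain,
        operatorOfResolvent J z₁ hinj₁ ⟨u, hu⟩ + K u = w :=
  h.exists_mem_domain_iff_of_mem hz₀ hz₁ u fun y => y + K u = w

end IsPseudoResolvent

end Literature.Analysis.OperatorTheory

end
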